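import Summits.KontsevichZagierPeriods.KontsevichZagierPeriods.Theses.InverseLandau
import Literature.NumberTheory.Transcendental.RosenlichtProp4Residues

/-!
# `LandauLocalisation` (stmt-KontsevichZagierPeriods-13874, route `InverseLandau`, support item)

LOCALISATION ("multiplicatively independent singularities never cancel"), the `Λ = 0` case of
inverse Landau in dimension one: for a field `k` of characteristic `0`, DISTINCT non-zero
`λ₁, …, λₘ ∈ k`, power series `Cᵢ ∈ k⟦X⟧` algebraic over `k[X]`, and the formal logarithms
`Lᵢ = log(1 - λᵢX)` (pinned by `Lᵢ(0) = 0`, `(1 - λᵢX)·Lᵢ' = -λᵢ`), a relation `Σ Cᵢ Lᵢ = 0`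
forces every `Cᵢ = 0`.

Proof ("by Ax", as on the route card). Work in the Laurent series field `K = k⸨X⸩` with the
Euler derivation `θ = X·d/dX` (`Literature.NumberTheory.Transcendental.LaurentEuler.eulerDerivation`),
whose constants are exactly `k`. With `yᵢ = Lᵢ`, `zᵢ = 1 - λᵢX` one has `θ zᵢ = zᵢ θ yᵢ`, and the
`yᵢ` are `ℚ`-linearly independent modulo constants (`θ(Σ qᵢ Lᵢ) = 0` gives `Σ qᵢ λᵢ^{n+1} = 0`
for all `n`, a Vandermonde system in the distinct non-zero `λᵢ`). Ax's theorem — the tree's PROVED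
`ax_schanuel_of_field` with `Rosenlicht.Rosenlicht1976_prop4_holds` (= `ax_schanuel_holds`,
Ax 1971 Thm. 3 via Rosenlicht 1976 Prop. 4) — yields `m + 1 ≤ trdeg_k k[y, z]` (the rank term
is `1` since `θ L₁ ≠ 0`). On the other hand a relation `Σ Cᵢ Lᵢ = 0` with `C_{i₁} ≠ 0` and all `Cᵢ`
algebraic over `k[X]` puts `k[y, z]` inside the field `k(X, (Lᵢ)_{i ≠ i₁})(C, L_{i₁})`, which is
algebraic over `F₁ = k(X, (Lᵢ)_{i ≠ i₁})`, a field generated by `m` elements; so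
`trdeg_k k[y, z] ≤ trdeg_k F₁ ≤ m` (`trdeg_add_eq`, `trdeg_le_cardinalMk`) — contradiction.

References: J. Ax, Ann. of Math. 93 (1971), Thm. 3; M. Rosenlicht, Pacific J. Math. 65 (1976), Prop. 4.
-/

noncomputable section

open scoped LaurentSeries PowerSeries Cardinal

namespace Summit.KontsevichZagierPeriods.InverseLandau

open Literature.NumberTheory.Transcendental

/-! ### Laurent series: constants of `θ = X·d/dX`, and `θ` on power series -/

section Laurent

variable {k : Type*} [Field k]

/-- The constants of the Euler derivation `θ = X·d/dX` of `k⸨X⸩` (characteristic `0`) are the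
constant series: `θ x = 0` forces `n·xₙ = 0`, i.e. `xₙ = 0` for `n ≠ 0`. [folklore] -/
theorem mem_range_algebraMap_of_eulerDerivation_eq_zero [CharZero k] (x : k⸨X⸩)
    (hx : LaurentEuler.eulerDerivation k x = 0) : x ∈ Set.range (algebraMap k k⸨X⸩) := by
  refine ⟨x.coeff 0, ?_⟩
  rw [LaurentEuler.algebraMap_laurent_eq_C]
  ext n
  rw [HahnSeries.C_apply, HahnSeries.coeff_single]
  split_ifs with h
  · rw [h]
  · have h1 := congrArg (fun y : k⸨X⸩ => y.coeff n) hx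
    simp only [LaurentEuler.coeff_eulerDerivation, HahnSeries.coeff_zero, mul_eq_zero,
      Int.cast_eq_zero] at h1
    exact (h1.resolve_left h).symm

/-- `θ = X·d/dX` on (the image of) a power series `q` is the power series `X · q'`. [folklore] -/
theorem eulerDerivation_coe_powerSeries (q : k⟦X⟧) :
    LaurentEuler.eulerDerivation k (q : k⸨X⸩) =
      ((PowerSeries.X * PowerSeries.derivative k q : k⟦X⟧) : k⸨X⸩) := by
  rw [LaurentEuler.eulerDerivation_ofPowerSeries]
  congr 1
  ext n
  rw [PowerSeries.coeff_mk]
  cases n with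
  | zero => rw [PowerSeries.coeff_zero_X_mul, Nat.cast_zero, zero_mul]
  | succ n =>
    rw [PowerSeries.coeff_succ_X_mul, PowerSeries.coeff_derivative]
    push_cast
    ring

/-- The geometric series: `(1 - aX) · Σ aⁿXⁿ = 1` in `k⟦X⟧`. [folklore] -/
theorem one_sub_C_mul_X_mul_mk_pow (a : k) :
    ((1 : k⟦X⟧) - PowerSeries.C a * PowerSeries.X) * PowerSeries.mk (fun n => a ^ n) = 1 := by
  ext n
  rw [sub_mul, one_mul, map_sub, mul_assoc, PowerSeries.coeff_C_mul]
  cases n with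
  | zero =>
    rw [PowerSeries.coeff_zero_X_mul, mul_zero, sub_zero, PowerSeries.coeff_mk, pow_zero,
      PowerSeries.coeff_zero_eq_constantCoeff, map_one]
  | succ n =>
    rw [PowerSeries.coeff_succ_X_mul, PowerSeries.coeff_mk, PowerSeries.coeff_mk,
      PowerSeries.coeff_one, if_neg (Nat.succ_ne_zero n), pow_succ', sub_self]

/-- The formal logarithm `L = log(1 - aX)`, pinned by `(1 - aX)·L' = -a`, has derivative
`L' = -a · Σ aⁿXⁿ`. [folklore] -/
theorem derivative_eq_of_landau {a : k} {Lq : k⟦X⟧}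
    (h : ((1 : k⟦X⟧) - PowerSeries.C a * PowerSeries.X) * PowerSeries.derivative k Lq =
      -PowerSeries.C a) :
    PowerSeries.derivative k Lq = -(PowerSeries.C a * PowerSeries.mk fun n => a ^ n) := by
  have hG := one_sub_C_mul_X_mul_mk_pow a
  calc PowerSeries.derivative k Lq
      = (((1 : k⟦X⟧) - PowerSeries.C a * PowerSeries.X) * PowerSeries.mk (fun n => a ^ n)) *
          PowerSeries.derivative k Lq := by rw [hG, one_mul]
    _ = (((1 : k⟦X⟧) - PowerSeries.C a * PowerSeries.X) * PowerSeries.derivative k Lq) *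
          PowerSeries.mk (fun n => a ^ n) := by ring
    _ = -(PowerSeries.C a * PowerSeries.mk fun n => a ^ n) := by rw [h, neg_mul]

/-- Coefficients of `L' = -a/(1 - aX)`: `L'ₙ = -a^{n+1}`. [folklore] -/
theorem coeff_derivative_of_landau {a : k} {Lq : k⟦X⟧}
    (h : ((1 : k⟦X⟧) - PowerSeries.C a * PowerSeries.X) * PowerSeries.derivative k Lq =
      -PowerSeries.C a) (n : ℕ) :
    PowerSeries.coeff n (PowerSeries.derivative k Lq) = -a ^ (n + 1) := by
  rw [derivative_eq_of_landau h, map_neg, PowerSeries.coeff_C_mul, PowerSeries.coeff_mk, pow_succ']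

/-- **`ℚ`-linear independence of the logarithms modulo constants.** For distinct non-zero `λᵢ`
and `Lᵢ = log(1 - λᵢX)`: if `θ(Σ qᵢ Lᵢ) = 0` in `k⸨X⸩` (`qᵢ ∈ ℤ`, `θ = X·d/dX`) then `q = 0` —
the coefficient of `X^{n+1}` of `X·Σ qᵢLᵢ'` is `-Σ qᵢ λᵢ^{n+1}`, and the Vandermonde system in the
distinct `λᵢ` forces `qᵢλᵢ = 0`. [folklore] -/
theorem eq_zero_of_eulerDerivation_sum_eq_zero [CharZero k] {m : ℕ} {lam : Fin m → k}
    (hinj : Function.Injective lam) (hne : ∀ i, lam i ≠ 0) {L : Fin m → k⟦X⟧}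
    (hL : ∀ i, ((1 : k⟦X⟧) - PowerSeries.C (lam i) * PowerSeries.X) *
      PowerSeries.derivative k (L i) = -PowerSeries.C (lam i))
    (q : Fin m → ℤ)
    (hq : LaurentEuler.eulerDerivation k (∑ i, (q i : k⸨X⸩) * ((L i : k⟦X⟧) : k⸨X⸩)) = 0) :
    q = 0 := by
  -- the power series `Σ qᵢ · X·Lᵢ'` vanishes
  have h1 : (∑ i, (q i : k⟦X⟧) * (PowerSeries.X * PowerSeries.derivative k (L i))) = 0 := by
    apply HahnSeries.ofPowerSeries_injective (Γ := ℤ) (R := k)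
    rw [map_sum, map_zero, ← hq, map_sum]
    refine Finset.sum_congr rfl fun i _ => ?_
    rw [map_mul, map_intCast, Derivation.leibniz, Derivation.map_intCast, smul_zero, add_zero,
      smul_eq_mul, eulerDerivation_coe_powerSeries]
  -- coefficients: `Σ qᵢ λᵢ^{n+1} = 0`
  have h2 : ∀ n : ℕ, ∑ i, ((q i : k) * lam i) * lam i ^ n = 0 := by
    intro n
    have h3 := congrArg (PowerSeries.coeff (R := k) (n + 1)) h1
    rw [map_sum, map_zero] at h3
    have h4 : ∀ i, PowerSeries.coeff (n + 1)
        ((q i : k⟦X⟧) * (PowerSeries.X * PowerSeries.derivative k (L i))) =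
          -(((q i : k) * lam i) * lam i ^ n) := fun i => by
      rw [← map_intCast (PowerSeries.C (R := k)) (q i), PowerSeries.coeff_C_mul,
        PowerSeries.coeff_succ_X_mul, coeff_derivative_of_landau (hL i)]
      ring
    simpa only [h4, Finset.sum_neg_distrib, neg_eq_zero] using h3
  have hv := Matrix.eq_zero_of_forall_pow_sum_mul_pow_eq_zero
    (v := fun i => (q i : k) * lam i) hinj (fun i => h2 i)
  funext i
  have h5 := congrFun hv i
  simp only [Pi.zero_apply, mul_eq_zero, Int.cast_eq_zero] at h5
  exact h5.resolve_right (hne i)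

/-- Evaluating a polynomial at `X = single 1 1 ∈ k⸨X⸩` is the embedding `k[X] → k⟦X⟧ → k⸨X⸩`.
[folklore] -/
theorem aeval_single_one (p : Polynomial k) :
    Polynomial.aeval (HahnSeries.single (1 : ℤ) (1 : k)) p = ((p : k⟦X⟧) : k⸨X⸩) := by
  induction p using Polynomial.induction_on' with
  | add p q hp hq => rw [map_add, hp, hq, Polynomial.coe_add, PowerSeries.coe_add]
  | monomial n a =>
    rw [← Polynomial.C_mul_X_pow_eq_monomial, map_mul, map_pow, Polynomial.aeval_C,
      Polynomial.aeval_X, LaurentEuler.algebraMap_laurent_eq_C, Polynomial.coe_mul,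
      Polynomial.coe_pow, Polynomial.coe_C, Polynomial.coe_X, PowerSeries.coe_mul,
      PowerSeries.coe_pow, PowerSeries.coe_C, PowerSeries.coe_X]

/-- A power series `C` algebraic over `k[X]` (a non-zero `R ∈ k[X][Y]` with `R(C) = 0` in `k⟦X⟧`)
is, inside `k⸨X⸩`, algebraic over every intermediate field containing `X`: transport `R` along
`k[X] → F`, `X ↦ X` (injective, as `X` is transcendental). [folklore] -/
theorem isAlgebraic_coe_of_eval₂ {Cq : k⟦X⟧} {R : Polynomial (Polynomial k)} (hR : R ≠ 0)
    (hev : Polynomial.eval₂ (Polynomial.coeToPowerSeries.ringHom (R := k)) Cq R = 0)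
    (F : IntermediateField k k⸨X⸩) (hX : (HahnSeries.single (1 : ℤ) (1 : k) : k⸨X⸩) ∈ F) :
    IsAlgebraic F ((Cq : k⟦X⟧) : k⸨X⸩) := by
  set XF : F := ⟨HahnSeries.single 1 1, hX⟩ with hXF
  set φ : Polynomial k →+* F := (Polynomial.aeval XF).toRingHom with hφ
  have hφK : ∀ p : Polynomial k, ((φ p : F) : k⸨X⸩) = ((p : k⟦X⟧) : k⸨X⸩) := fun p => by
    change algebraMap F k⸨X⸩ (Polynomial.aeval XF p) = _
    rw [← Polynomial.aeval_algebraMap_apply, show algebraMap F k⸨X⸩ XF = HahnSeries.single 1 1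
      from rfl, aeval_single_one]
  have hφinj : Function.Injective φ := fun p p' hpp' => by
    have h1 := congrArg (fun t : F => (t : k⸨X⸩)) hpp'
    simp only [hφK] at h1
    exact Polynomial.coe_injective k (HahnSeries.ofPowerSeries_injective h1)
  refine ⟨R.map φ, (Polynomial.map_ne_zero_iff hφinj).mpr hR, ?_⟩
  rw [Polynomial.aeval_def, Polynomial.eval₂_map]
  have hcomp : (algebraMap F k⸨X⸩).comp φ =
      (HahnSeries.ofPowerSeries ℤ k).comp (Polynomial.coeToPowerSeries.ringHom (R := k)) :=
    RingHom.ext fun p => hφK p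
  rw [hcomp, ← Polynomial.hom_eval₂, hev, map_zero]

end Laurent

/-! ### Transcendence degree: an upper bound from an algebraic relation -/

section Trdeg

/-- `F(T)` is algebraic over its `F`-subalgebra generated by (the preimage of) `T` (it is its
fraction field). [folklore] -/
theorem isAlgebraic_algebraAdjoin_preimage {F E : Type*} [Field F] [Field E] [Algebra F E]
    (T : Set E) :
    Algebra.IsAlgebraic
      (Algebra.adjoin F (((↑) : IntermediateField.adjoin F T → E) ⁻¹' T))
      (IntermediateField.adjoin F T) := by
  set E' := IntermediateField.adjoin F T
  rw [← IntermediateField.isAlgebraic_adjoin_iff_top]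
  have h : IntermediateField.adjoin F (((↑) : E' → E) ⁻¹' T) = ⊤ := by
    apply IntermediateField.lift_injective E'
    rw [IntermediateField.lift_adjoin, IntermediateField.lift_top,
      Set.image_preimage_eq_of_subset]
    intro x hx
    exact ⟨⟨x, IntermediateField.subset_adjoin F T hx⟩, rfl⟩
  rw [h]
  haveI : Algebra.IsIntegral (⊤ : IntermediateField F E') E' :=
    Algebra.isIntegral_of_surjective fun x => ⟨⟨x, trivial⟩, rfl⟩
  exact Algebra.IsIntegral.isAlgebraic

/-- **Upper bound.** Let `y, z, C : Fin m → K`, `X ∈ K`, with every `zᵢ` in, and every `Cᵢ`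
algebraic over, each intermediate field containing `X`; if `Σ Cᵢ yᵢ = 0` with `C_{i₁} ≠ 0` then
`trdeg_k k[y, z] ≤ m`: indeed `k[y, z] ⊆ F₁(y, z, C)` with `F₁ = k(X, (yᵢ)_{i ≠ i₁})` generated by
`m` elements, and `F₁(y, z, C)/F₁` is algebraic (`y_{i₁} = -C_{i₁}⁻¹ Σ_{i ≠ i₁} Cᵢ yᵢ`).
[folklore] -/
theorem trdeg_adjoin_le_of_relation {k K : Type} [Field k] [Field K] [Algebra k K] {m : ℕ}
    (y z Cc : Fin m → K) (Xs : K) (i₁ : Fin m)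
    (hz : ∀ i, ∀ F : IntermediateField k K, Xs ∈ F → z i ∈ F)
    (hC : ∀ i, ∀ F : IntermediateField k K, Xs ∈ F → IsAlgebraic F (Cc i))
    (hC₁ : Cc i₁ ≠ 0) (hrel : ∑ i, Cc i * y i = 0) :
    Algebra.trdeg k (Algebra.adjoin k (Set.range y ∪ Set.range z)) ≤ (m : Cardinal) := by
  classical
  set e : Fin m → K := Function.update y i₁ Xs with he
  set F₁ : IntermediateField k K := IntermediateField.adjoin k (Set.range e) with hF₁
  have heF₁ : ∀ i, e i ∈ F₁ := fun i => IntermediateField.subset_adjoin k _ ⟨i, rfl⟩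
  have hXs : Xs ∈ F₁ := by
    have h := heF₁ i₁
    rwa [he, Function.update_self] at h
  have hy : ∀ i, i ≠ i₁ → y i ∈ F₁ := fun i hi => by
    have h := heF₁ i
    rwa [he, Function.update_of_ne hi] at h
  set T₁ : Set K := Set.range y ∪ Set.range z ∪ Set.range Cc with hT₁
  -- every generator is algebraic over `F₁`
  have halg : ∀ x ∈ T₁, IsAlgebraic F₁ x := by
    rintro x ((⟨i, rfl⟩ | ⟨i, rfl⟩) | ⟨i, rfl⟩)
    · by_cases hi : i = i₁
      · subst hi
        refine IsAlgebraic.of_mul (mem_nonZeroDivisors_of_ne_zero hC₁) (hC i F₁ hXs) ?_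
        have hsplit := Finset.add_sum_erase Finset.univ (fun j => Cc j * y j) (Finset.mem_univ i)
        rw [hrel] at hsplit
        rw [eq_neg_of_add_eq_zero_left hsplit]
        refine (Subalgebra.mem_algebraicClosure (R := F₁) (S := K)).mp ?_
        refine neg_mem (sum_mem fun j hj => mul_mem ?_ ?_)
        · exact (Subalgebra.mem_algebraicClosure (R := F₁) (S := K)).mpr (hC j F₁ hXs)
        · exact (Subalgebra.mem_algebraicClosure (R := F₁) (S := K)).mpr
            (isAlgebraic_algebraMap (⟨y j, hy j (Finset.ne_of_mem_erase hj)⟩ : F₁))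
      · exact isAlgebraic_algebraMap (⟨y i, hy i hi⟩ : F₁)
    · exact isAlgebraic_algebraMap (⟨z i, hz i F₁ hXs⟩ : F₁)
    · exact hC i F₁ hXs
  set F₂ : IntermediateField F₁ K := IntermediateField.adjoin F₁ T₁ with hF₂
  haveI : Algebra.IsAlgebraic F₁ F₂ :=
    IntermediateField.isAlgebraic_adjoin fun x hx => (halg x hx).isIntegral
  -- the inclusion `k[y, z] → F₂`
  have hle : Algebra.adjoin k (Set.range y ∪ Set.range z) ≤ (F₂.restrictScalars k).toSubalgebra :=
    Algebra.adjoin_le fun t ht => IntermediateField.subset_adjoin F₁ T₁ (Or.inl ht)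
  let ι : Algebra.adjoin k (Set.range y ∪ Set.range z) →ₐ[k] F₂ :=
    { toFun := fun t => ⟨t.1, hle t.2⟩
      map_one' := rfl
      map_mul' := fun _ _ => rfl
      map_zero' := rfl
      map_add' := fun _ _ => rfl
      commutes' := fun _ => rfl }
  have hι : Function.Injective ι := fun a b hab =>
    Subtype.ext (congrArg (fun t : F₂ => (t : K)) hab)
  -- counting
  haveI := isAlgebraic_algebraAdjoin_preimage (F := k) (Set.range e)
  have hF₁m : Algebra.trdeg k F₁ ≤ (m : Cardinal) := by
    calc Algebra.trdeg k F₁ ≤ #(((↑) : F₁ → K) ⁻¹' Set.range e) :=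
          Algebra.IsAlgebraic.trdeg_le_cardinalMk k _
      _ ≤ #(Set.range e) := Cardinal.mk_preimage_of_injective _ _ Subtype.val_injective
      _ ≤ #(Fin m) := Cardinal.mk_range_le
      _ = m := Cardinal.mk_fin m
  haveI : FaithfulSMul F₁ F₂ :=
    (faithfulSMul_iff_algebraMap_injective F₁ F₂).mpr (algebraMap F₁ F₂).injective
  haveI : FaithfulSMul k F₁ :=
    (faithfulSMul_iff_algebraMap_injective k F₁).mpr (algebraMap k F₁).injective
  have htower := trdeg_add_eq k F₁ (A := F₂)
  calc Algebra.trdeg k (Algebra.adjoin k (Set.range y ∪ Set.range z))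
      ≤ Algebra.trdeg k F₂ := trdeg_le_of_injective ι hι
    _ = Algebra.trdeg k F₁ + Algebra.trdeg F₁ F₂ := htower.symm
    _ = Algebra.trdeg k F₁ := by rw [trdeg_eq_zero (R := F₁) (A := F₂), add_zero]
    _ ≤ m := hF₁m

end Trdeg

/-! ### The item -/

/-- **`LandauLocalisation`** (route `InverseLandau`, item stmt-KontsevichZagierPeriods-13874):
for a field `k` of characteristic `0`, distinct non-zero `λᵢ ∈ k`, `Cᵢ ∈ k⟦X⟧` algebraic over
`k[X]` and `Lᵢ ∈ k⟦X⟧` with `Lᵢ(0) = 0`, `(1 - λᵢX)·Lᵢ' = -λᵢ` (so `Lᵢ = log(1 - λᵢX)`),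
`Σ Cᵢ Lᵢ = 0` forces every `Cᵢ = 0`. Proof by Ax's theorem (`ax_schanuel_of_field`,
`Rosenlicht1976_prop4_holds`) for `θ = X·d/dX` on `k⸨X⸩` against the transcendence-degree bound
`trdeg_adjoin_le_of_relation`; see the module docstring. [cite: Ax1971, Thm. 3] -/
theorem landauLocalisation_proof :
    Summit.KontsevichZagierPeriods.KontsevichZagierPeriods.Theses.InverseLandau.LandauLocalisation := by
  unfold Summit.KontsevichZagierPeriods.KontsevichZagierPeriods.Theses.InverseLandau.LandauLocalisation
  intro k _ _ m lam C L hinj hne halg hL hsum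
  classical
  by_contra hcon
  simp only [not_forall] at hcon
  obtain ⟨i₁, hi₁⟩ := hcon
  haveI : CharZero k⸨X⸩ := charZero_of_injective_algebraMap (algebraMap k k⸨X⸩).injective
  -- the data for Ax's theorem
  set θ := LaurentEuler.eulerDerivation k with hθ
  -- Ax's theorem is typed with the `k`-module structure on `k⸨X⸩` induced by `algebraMap`
  -- (`Algebra.toModule`), which is not definitionally the coefficientwise one carried by
  -- `LaurentEuler.eulerDerivation`; re-bundle `θ` for the former (it kills `algebraMap k k⸨X⸩`).
  let θL : @LinearMap k k _ _ (RingHom.id k) k⸨X⸩ k⸨X⸩ _ _ Algebra.toModule Algebra.toModule :=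
    @LinearMap.mk k k _ _ (RingHom.id k) k⸨X⸩ k⸨X⸩ _ _ Algebra.toModule Algebra.toModule
      ⟨θ, map_add θ⟩ (fun c x => by
        show θ (algebraMap k k⸨X⸩ c * x) = algebraMap k k⸨X⸩ c * θ x
        rw [Derivation.leibniz, Derivation.map_algebraMap, smul_zero, add_zero, smul_eq_mul])
  let θ' : @Derivation k k⸨X⸩ k⸨X⸩ _ _ _ _ _ Algebra.toModule :=
    @Derivation.mk k k⸨X⸩ k⸨X⸩ _ _ _ _ _ Algebra.toModule θL θ.map_one_eq_zero
      (fun a b => θ.leibniz a b)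
  have hθ' : ∀ x, θ' x = θ x := fun _ => rfl
  let D := fun _ : Fin 1 => θ'
  set y : Fin m → k⸨X⸩ := fun i => ((L i : k⟦X⟧) : k⸨X⸩) with hy
  set g : Fin m → k⟦X⟧ := fun i => (1 : k⟦X⟧) - PowerSeries.C (lam i) * PowerSeries.X with hg
  set z : Fin m → k⸨X⸩ := fun i => ((g i : k⟦X⟧) : k⸨X⸩) with hz
  set Cc : Fin m → k⸨X⸩ := fun i => ((C i : k⟦X⟧) : k⸨X⸩) with hCc
  have hdg : ∀ i, PowerSeries.derivative k (g i) = -PowerSeries.C (lam i) := fun i => by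
    simp only [hg]
    rw [map_sub, Derivation.map_one_eq_zero, Derivation.leibniz, PowerSeries.derivative_X,
      PowerSeries.derivative_C, smul_zero, add_zero, smul_eq_mul, mul_one, zero_sub]
  have hθy : ∀ i, θ (y i) =
      ((PowerSeries.X * PowerSeries.derivative k (L i) : k⟦X⟧) : k⸨X⸩) :=
    fun i => eulerDerivation_coe_powerSeries (L i)
  have hθz : ∀ i, θ (z i) = ((-(PowerSeries.X * PowerSeries.C (lam i)) : k⟦X⟧) : k⸨X⸩) :=
    fun i => by simp only [hz]; rw [eulerDerivation_coe_powerSeries, hdg, mul_neg]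
  -- hypotheses of Ax's theorem
  have hC0 : ∀ x : k⸨X⸩, (∀ j : Fin 1, D j x = 0) → x ∈ Set.range (algebraMap k k⸨X⸩) :=
    fun x hx => mem_range_algebraMap_of_eulerDerivation_eq_zero x (by rw [← hθ']; exact hx 0)
  have hz0 : ∀ i, z i ≠ 0 := fun i h => by
    have h' : g i = 0 := HahnSeries.ofPowerSeries_injective (by simp only [hz] at h; rw [h, map_zero])
    simpa [hg] using congrArg PowerSeries.constantCoeff h'
  have hexp : ∀ (j : Fin 1) (i : Fin m), D j (z i) = z i * D j (y i) := fun j i => by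
    show θ' (z i) = z i * θ' (y i)
    rw [hθ', hθ', hθz, hθy]
    simp only [hz]
    rw [← PowerSeries.coe_mul]
    congr 1
    have h := (hL i).2
    calc -(PowerSeries.X * PowerSeries.C (lam i))
        = PowerSeries.X * (((1 : k⟦X⟧) - PowerSeries.C (lam i) * PowerSeries.X) *
            PowerSeries.derivative k (L i)) := by rw [h, mul_neg]
      _ = g i * (PowerSeries.X * PowerSeries.derivative k (L i)) := by simp only [hg]; ring
  have hind : ∀ q : Fin m → ℤ, (∀ j : Fin 1, D j (∑ i, (q i : k⸨X⸩) * y i) = 0) → q = 0 :=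
    fun q hq => eq_zero_of_eulerDerivation_sum_eq_zero hinj hne (fun i => (hL i).2) q
      (by rw [← hθ']; exact hq 0)
  have hAx := ax_schanuel_of_field Rosenlicht.Rosenlicht1976_prop4_holds D hC0 y z hz0 hexp hind
  -- the rank term is `1`
  have hrank : 1 ≤ (Matrix.of fun i j => D j (y i)).rank := by
    set M : Matrix (Fin m) (Fin 1) k⸨X⸩ := Matrix.of fun i j => D j (y i) with hM
    have hcol : M.col 0 ≠ 0 := by
      intro h
      have h1 : θ' (y i₁) = 0 := congrFun h i₁
      rw [hθ', hθy] at h1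
      have h2 : PowerSeries.X * PowerSeries.derivative k (L i₁) = 0 :=
        HahnSeries.ofPowerSeries_injective (by rw [h1, map_zero])
      have h3 : PowerSeries.derivative k (L i₁) ≠ 0 := fun h4 => by
        have h5 := congrArg (PowerSeries.coeff (R := k) 0) h4
        rw [coeff_derivative_of_landau (hL i₁).2, map_zero, zero_add, pow_one, neg_eq_zero] at h5
        exact hne i₁ h5
      exact mul_ne_zero PowerSeries.X_ne_zero h3 h2
    rw [Matrix.rank_eq_finrank_span_cols]
    calc 1 = Module.finrank k⸨X⸩ (Submodule.span k⸨X⸩ {M.col 0}) :=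
          (finrank_span_singleton hcol).symm
      _ ≤ Module.finrank k⸨X⸩ (Submodule.span k⸨X⸩ (Set.range M.col)) :=
          Submodule.finrank_mono (Submodule.span_mono (Set.singleton_subset_iff.mpr ⟨0, rfl⟩))
  -- the upper bound
  have hup : Algebra.trdeg k (Algebra.adjoin k (Set.range y ∪ Set.range z)) ≤ (m : Cardinal) := by
    refine trdeg_adjoin_le_of_relation y z Cc (HahnSeries.single 1 1) i₁ ?_ ?_ ?_ ?_
    · intro i F hXF
      have h1 : z i = 1 - algebraMap k k⸨X⸩ (lam i) * HahnSeries.single 1 1 := by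
        simp only [hz, hg]
        rw [PowerSeries.coe_sub, PowerSeries.coe_one, PowerSeries.coe_mul, PowerSeries.coe_C,
          PowerSeries.coe_X, LaurentEuler.algebraMap_laurent_eq_C]
      rw [h1]
      exact sub_mem (one_mem F) (mul_mem (algebraMap_mem F (lam i)) hXF)
    · intro i F hXF
      obtain ⟨R, hR, hev⟩ := halg i
      exact isAlgebraic_coe_of_eval₂ hR hev F hXF
    · simp only [hCc]
      exact (map_ne_zero_iff _ HahnSeries.ofPowerSeries_injective).mpr hi₁
    · have h1 := congrArg (HahnSeries.ofPowerSeries ℤ k) hsum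
      rw [map_sum, map_zero] at h1
      simpa only [map_mul] using h1
  -- contradiction: `m + 1 ≤ trdeg ≤ m`
  have hle : ((m + 1 : ℕ) : Cardinal) ≤ (m : Cardinal) := by
    calc ((m + 1 : ℕ) : Cardinal)
        ≤ ((m + (Matrix.of fun i j => D j (y i)).rank : ℕ) : Cardinal) := by
          exact_mod_cast Nat.add_le_add_left hrank m
      _ ≤ Algebra.trdeg k (Algebra.adjoin k (Set.range y ∪ Set.range z)) := hAx
      _ ≤ m := hup
  have := (Nat.cast_le (α := Cardinal)).mp hle
  omega

end Summit.KontsevichZagierPeriods.InverseLandau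

end
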